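import Summits.ResolutionOfSingularities.ResolutionOfSingularities.Theorems.RadicialJungCleanModelsGiraudStepPointTrichotomy
import Summits.ResolutionOfSingularities.ResolutionOfSingularities.Theorems.RadicialJungCleanModelsGiraudCriticalPrimesAdapters
import HarnessLib

/-!
# Route `RadicialJung`, crux `CleanModels` (stmt-15917): the critical primes on the charts of the
# blow-up, from "height-one primes over the equation of `E`" (T2 `stub_lemma23`, glue)

Support file (OURS) for PROGRAMME-clean-dim2 / T2, line `via-clean-models` of the crux
`DescentPerfectToAll` (stmt-0549). Nothing here is a statement of Hironaka's manuscript.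

Setting of `RadicialJungCleanModelsGiraudStepPointTrichotomy.lean`: `R ≤ R[y/x] ≤ T ⊆ K`, `R`
regular local of dimension two with regular parameters `(x, y)`, `T = R[y/x]_Q` (`Q ∋ x`).
Geometry (res-D-pv-030's `…T2CriticalPrimesStalk.lean`) hands the critical primes of the
pulled-back germ as "the height-one primes of `T` containing the image of the local equation
`g = x` (non-crossing point) or `g = xy` (crossing point) of `E(f)`"; the algebra
(`giraudColength_lt_of_chart`, `giraud23_trichotomy_of_oppositeChart_origin`) wants explicit lists.
This file converts:

* `prime_inclusion_of_chart` — `x` is a prime element of `T` (`𝔪_R R[y/x] = x R[y/x]` is prime,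
  Huneke–Swanson p. 264, and localisation);
* `maximalIdeal_eq_span_pair_of_chart` — at the origin of the chart (`y/x ∈ 𝔪_T`):
  `𝔪_T = (x, y/x)`;
* `span_singleton_ne_of_chart_origin` — there `(x) ≠ (y/x)`;
* `derivCriticalPrimes_chart_of_mem₁` / `…_of_mem₂` — on the chart of `x`: the lists `{(x)}`
  (non-crossing) and "the non-units among `(x), (y/x)`" (crossing);
* `derivCriticalPrimes_chart_origin_of_mem₁` / `…_of_mem₂` — at the origin of the chart of `y`
  (`x/y ∈ 𝔪_T`): the lists `{(y), (x/y)}` and "the non-units among `(y), (x/y)`".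

References: J. Giraud, Bull. SMF 111 (1983), 1.2–1.3, Lemme 2.3 [Giraud1983];
C. Huneke, I. Swanson, Integral closure of ideals, rings, and modules, §14.2.
-/

noncomputable section

set_option linter.dupNamespace false -- mandated namespace of this single-conjunct summit

open IsLocalRing Literature.AlgebraicGeometry.Resolution Polynomial

namespace Summit.ResolutionOfSingularities.ResolutionOfSingularities.Theorems.RadicialJung.CleanModels

universe u

variable {K : Type u} [Field K] {R T : Subring K} {x y : R}

/-! ## `x` is prime in `T`, and the maximal ideal at the origin of the chart -/

/-- **`x` is a prime element of `T = R[y/x]_Q`** (`Q ∋ x`): `x R[y/x] = 𝔪_R R[y/x]` is a prime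
ideal (`R[y/x]/x R[y/x] ≅ (R/𝔪)[X]`), contained in `Q`, so its localisation is prime.
[cite: HunekeSwanson2006, §14.2 (p. 264)] -/
theorem prime_inclusion_of_chart [IsRegularLocalRing R] (hdim : ringKrullDim R = 2)
    (hm : maximalIdeal R = Ideal.span {x, y}) (hRT : R ≤ T) (hAT : chartAdjoin (K := K) x y ≤ T)
    [Algebra (chartAdjoin (K := K) x y) T]
    (halgT : algebraMap (chartAdjoin (K := K) x y) T = Subring.inclusion hAT)
    (Q : Ideal (chartAdjoin (K := K) x y)) [Q.IsPrime] (hxQ : chartIncl x y x ∈ Q)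
    [IsLocalization.AtPrime T Q] : Prime (Subring.inclusion hRT x) := by
  have hx := prime_and_not_dvd_of_maximalIdeal_eq_span_pair hdim hm
  have hx0 : x ≠ 0 := hx.1.ne_zero
  have hpq : ∀ t : R, x ∣ y * t → x ∣ t := fun t h => (hx.1.dvd_or_dvd h).resolve_left hx.2
  have hxm : x ∈ maximalIdeal R := hm ▸ Ideal.subset_span (by simp)
  have hym : y ∈ maximalIdeal R := hm ▸ Ideal.subset_span (by simp)
  -- `𝔪_R R[y/x] = (x)` is prime
  have hI : ((maximalIdeal R).map (chartIncl (K := K) x y)).IsPrime := isPrime_map_incl hx0 hpq hxm hym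
  rw [map_maximalIdeal_chartIncl hm hx0] at hI
  -- its localisation at `Q ⊇ (x)` is prime
  have hdisj : Disjoint (Q.primeCompl : Set (chartAdjoin (K := K) x y))
      (Ideal.span {chartIncl (K := K) x y x} : Ideal _) := by
    rw [Set.disjoint_left]
    intro a ha haI
    exact ha ((Ideal.span_singleton_le_iff_mem _).mpr hxQ haI)
  have hP := IsLocalization.isPrime_of_isPrime_disjoint Q.primeCompl T _ hI hdisj
  have hmap : (Ideal.span {chartIncl (K := K) x y x}).map (algebraMap (chartAdjoin (K := K) x y) T) =
      Ideal.span {Subring.inclusion hRT x} := by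
    rw [Ideal.map_span, Set.image_singleton, halgT]
    rfl
  rw [hmap] at hP
  have hxT0 : Subring.inclusion hRT x ≠ 0 := fun h =>
    hx0 (Subtype.ext (by simpa using congrArg (fun z : T => (z : K)) h))
  exact (Ideal.span_singleton_prime hxT0).mp hP

/-- `y = x · (y/x)` in `T`. [folklore] -/
theorem inclusion_snd_eq_mul_div (hx0 : x ≠ 0) (hRT : R ≤ T) (hyxT : ((y : R) : K) / x ∈ T) :
    Subring.inclusion hRT y = Subring.inclusion hRT x * ⟨((y : R) : K) / x, hyxT⟩ := by
  have hx0K : ((x : R) : K) ≠ 0 := fun h => hx0 (Subtype.ext h)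
  apply Subtype.ext
  simp only [Subring.coe_inclusion, Subring.coe_mul]
  rw [mul_div_cancel₀ _ hx0K]

/-- **At the origin of the chart, `𝔪_T = (x, y/x)`**: if `y/x ∈ 𝔪_T` (`T = R[y/x]_Q`, `Q ∋ x`) then
the maximal ideal of `T` is generated by `x` and `y/x` (every `a = F(y/x) ∈ Q` has
`F(0) ∈ Q ∩ R = 𝔪_R = (x, y) ⊆ x R[y/x]`). [cite: HunekeSwanson2006, §14.2 (p. 264)] -/
theorem maximalIdeal_eq_span_pair_of_chart [IsLocalRing R] [IsLocalRing T]
    (hm : maximalIdeal R = Ideal.span {x, y}) (hx0 : x ≠ 0)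
    (hRT : R ≤ T) (hAT : chartAdjoin (K := K) x y ≤ T) (hyxT : ((y : R) : K) / x ∈ T)
    [Algebra (chartAdjoin (K := K) x y) T]
    (halgT : algebraMap (chartAdjoin (K := K) x y) T = Subring.inclusion hAT)
    (Q : Ideal (chartAdjoin (K := K) x y)) [Q.IsPrime] (hxQ : chartIncl x y x ∈ Q)
    [IsLocalization.AtPrime T Q]
    (hw : (⟨((y : R) : K) / x, hyxT⟩ : T) ∈ maximalIdeal T) :
    maximalIdeal T = Ideal.span {Subring.inclusion hRT x, ⟨((y : R) : K) / x, hyxT⟩} := by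
  let wA : chartAdjoin (K := K) x y := ⟨((y : R) : K) / x, Algebra.self_mem_adjoin_singleton R _⟩
  have halg_x : algebraMap (chartAdjoin (K := K) x y) T (chartIncl (K := K) x y x) =
      Subring.inclusion hRT x := by
    rw [halgT]; rfl
  have halg_w : algebraMap (chartAdjoin (K := K) x y) T wA = ⟨((y : R) : K) / x, hyxT⟩ := by
    rw [halgT]; rfl
  have hxT : Subring.inclusion hRT x ∈ maximalIdeal T := by
    rw [← halg_x]; exact (IsLocalization.AtPrime.to_map_mem_maximal_iff T Q _).mpr hxQ
  have hwQ : wA ∈ Q := (IsLocalization.AtPrime.to_map_mem_maximal_iff T Q _).mp (by rw [halg_w]; exact hw)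
  apply le_antisymm
  · -- `𝔪_T = Q T ⊆ (x, y/x)`
    rw [← IsLocalization.AtPrime.map_eq_maximalIdeal Q T, Ideal.map_le_iff_le_comap]
    intro a haQ
    obtain ⟨F, hF⟩ := exists_aeval_eq_of_mem_adjoin a.2
    let b : chartAdjoin (K := K) x y :=
      ⟨aeval (((y : R) : K) / x) F.divX, Polynomial.aeval_mem_adjoin_singleton R _⟩
    have hdec : a = wA * b + chartIncl (K := K) x y (F.coeff 0) := by
      apply Subtype.ext
      change (a : K) = ((y : R) : K) / x * aeval (((y : R) : K) / x) F.divX + ((F.coeff 0 : R) : K)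
      rw [← hF]
      conv_lhs => rw [← X_mul_divX_add F]
      rw [map_add, map_mul, aeval_X, aeval_C]
      rfl
    have hc : chartIncl (K := K) x y (F.coeff 0) ∈ Q := by
      have : chartIncl (K := K) x y (F.coeff 0) = a - wA * b := by rw [hdec]; ring
      rw [this]
      exact Q.sub_mem haQ (Q.mul_mem_right _ hwQ)
    have hc' : F.coeff 0 ∈ maximalIdeal R := by
      have hne : Q.comap (chartIncl (K := K) x y) ≠ ⊤ := by
        rw [Ne, Ideal.comap_eq_top_iff]; exact Ideal.IsPrime.ne_top inferInstance
      exact IsLocalRing.le_maximalIdeal hne (Ideal.mem_comap.mpr hc)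
    have hcx : chartIncl (K := K) x y (F.coeff 0) ∈ Ideal.span {chartIncl (K := K) x y x} := by
      rw [← map_maximalIdeal_chartIncl hm hx0]; exact Ideal.mem_map_of_mem _ hc'
    obtain ⟨c, hcdef⟩ := Ideal.mem_span_singleton'.mp hcx
    rw [Ideal.mem_comap, hdec, map_add, map_mul, halg_w, ← hcdef, map_mul, halg_x]
    refine Ideal.add_mem _ (Ideal.mul_mem_right _ _ (Ideal.subset_span (by simp)))
      (Ideal.mul_mem_left _ _ (Ideal.subset_span (by simp)))
  · rw [Ideal.span_le]
    rintro _ (rfl | rfl)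
    · exact hxT
    · exact hw

/-- At the origin of the chart (`𝔪_T = (x, y/x)`, `dim T = 2`), `(x) ≠ (y/x)`. [folklore] -/
theorem span_singleton_ne_of_chart_origin [IsRegularLocalRing T] (hdimT : ringKrullDim T = 2)
    (hRT : R ≤ T) (hyxT : ((y : R) : K) / x ∈ T)
    (hmT : maximalIdeal T = Ideal.span {Subring.inclusion hRT x, ⟨((y : R) : K) / x, hyxT⟩}) :
    (Ideal.span {Subring.inclusion hRT x} : Ideal T) ≠ Ideal.span {(⟨((y : R) : K) / x, hyxT⟩ : T)} := by
  intro h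
  apply maximalIdeal_ne_span_singleton hdimT (Subring.inclusion hRT x)
  rw [hmT]
  apply le_antisymm
  · rw [Ideal.span_le]
    rintro _ (rfl | rfl)
    · exact Ideal.subset_span rfl
    · show _ ∈ Ideal.span {Subring.inclusion hRT x}
      rw [h]; exact Ideal.subset_span rfl
  · exact Ideal.span_mono (by simp)

/-! ## The explicit lists on the chart of `x` -/

/-- **Chart of `x`, non-crossing centre**: if the critical primes of `f′ ∈ T` are the height-one
primes containing `x`, they are `{(x)}`. [cite: Giraud1983, 1.3 and Lemme 2.3 (ii)] -/
theorem derivCriticalPrimes_chart_of_mem₁ [IsRegularLocalRing R] [IsRegularLocalRing T]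
    (hdim : ringKrullDim R = 2)
    (hm : maximalIdeal R = Ideal.span {x, y}) (hRT : R ≤ T) (hAT : chartAdjoin (K := K) x y ≤ T)
    [Algebra (chartAdjoin (K := K) x y) T]
    (halgT : algebraMap (chartAdjoin (K := K) x y) T = Subring.inclusion hAT)
    (Q : Ideal (chartAdjoin (K := K) x y)) [Q.IsPrime] (hxQ : chartIncl x y x ∈ Q)
    [IsLocalization.AtPrime T Q] (f' : T)
    (hcrit : ∀ P : Ideal T, P ∈ derivCriticalPrimes T f' ↔
      (P.IsPrime ∧ P.height = 1 ∧ Subring.inclusion hRT x ∈ P)) :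
    ∀ P : Ideal T, P ∈ derivCriticalPrimes T f' ↔ P = Ideal.span {Subring.inclusion hRT x} :=
  fun P => mem_derivCriticalPrimes_iff_of_generator_pow f' (a := 1) le_rfl
    (prime_inclusion_of_chart hdim hm hRT hAT halgT Q hxQ) (fun P => by rw [hcrit P, pow_one]) P

/-- **Chart of `x`, crossing centre**: if the critical primes of `f′ ∈ T` are the height-one primes
containing `x·y = x²·(y/x)`, they are the non-units among `(x), (y/x)` (`y/x` is a unit off the
origin of the chart and a regular parameter at it). [cite: Giraud1983, 1.3 and Lemme 2.3 (i)] -/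
theorem derivCriticalPrimes_chart_of_mem₂ [IsRegularLocalRing R] [IsRegularLocalRing T]
    (hdim : ringKrullDim R = 2)
    (hdimT : ringKrullDim T = 2)
    (hm : maximalIdeal R = Ideal.span {x, y}) (hRT : R ≤ T) (hAT : chartAdjoin (K := K) x y ≤ T)
    (hyxT : ((y : R) : K) / x ∈ T) [Algebra (chartAdjoin (K := K) x y) T]
    (halgT : algebraMap (chartAdjoin (K := K) x y) T = Subring.inclusion hAT)
    (Q : Ideal (chartAdjoin (K := K) x y)) [Q.IsPrime] (hxQ : chartIncl x y x ∈ Q)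
    [IsLocalization.AtPrime T Q] (f' : T)
    (hcrit : ∀ P : Ideal T, P ∈ derivCriticalPrimes T f' ↔
      (P.IsPrime ∧ P.height = 1 ∧ Subring.inclusion hRT x * Subring.inclusion hRT y ∈ P)) :
    ∀ P : Ideal T, P ∈ derivCriticalPrimes T f' ↔
      ((¬ IsUnit (Subring.inclusion hRT x) ∧ P = Ideal.span {Subring.inclusion hRT x}) ∨
        (¬ IsUnit (⟨((y : R) : K) / x, hyxT⟩ : T) ∧ P = Ideal.span {(⟨((y : R) : K) / x, hyxT⟩ : T)})) := by
  have hxp := prime_inclusion_of_chart hdim hm hRT hAT halgT Q hxQ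
  have hx0 : x ≠ 0 := (prime_and_not_dvd_of_maximalIdeal_eq_span_pair hdim hm).1.ne_zero
  have hy : Subring.inclusion hRT y = Subring.inclusion hRT x * ⟨((y : R) : K) / x, hyxT⟩ :=
    inclusion_snd_eq_mul_div hx0 hRT hyxT
  have hz₂ : Prime (⟨((y : R) : K) / x, hyxT⟩ : T) ∨ IsUnit (⟨((y : R) : K) / x, hyxT⟩ : T) := by
    by_cases hw : (⟨((y : R) : K) / x, hyxT⟩ : T) ∈ maximalIdeal T
    · left
      have hmT := maximalIdeal_eq_span_pair_of_chart hm hx0 hRT hAT hyxT halgT Q hxQ hw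
      have hmT' : maximalIdeal T = Ideal.span {(⟨((y : R) : K) / x, hyxT⟩ : T), Subring.inclusion hRT x} := by
        rw [hmT, Set.pair_comm]
      exact (prime_and_not_dvd_of_maximalIdeal_eq_span_pair hdimT hmT').1
    · right
      rwa [mem_maximalIdeal, mem_nonunits_iff, not_not] at hw
  intro P
  have key : Subring.inclusion hRT x * Subring.inclusion hRT y =
      Subring.inclusion hRT x ^ 2 * (⟨((y : R) : K) / x, hyxT⟩ : T) ^ 1 := by
    rw [hy]; ring
  exact mem_derivCriticalPrimes_iff_of_generator_pow_mul_pow f' (a := 2) (b := 1) (by norm_num) le_rfl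
    hxp hz₂ (fun P => by rw [hcrit P, key]) P

/-! ## The explicit lists at the origin of the chart of `y` -/

/-- **Origin of the chart of `y`, non-crossing centre** (`E(f) = {x = 0}` at `ξ`): with
`𝔪_T = (y, x/y)`, if the critical primes of `f′` are the height-one primes containing
`x = y·(x/y)`, they are `{(y), (x/y)}`. [cite: Giraud1983, 1.3 and Lemme 2.3 (ii)] -/
theorem derivCriticalPrimes_chart_origin_of_mem₁ [IsRegularLocalRing T] (hdimT : ringKrullDim T = 2)
    (hy0 : y ≠ 0) (hRT : R ≤ T) (hxyT : ((x : R) : K) / y ∈ T)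
    (hmT : maximalIdeal T = Ideal.span {Subring.inclusion hRT y, ⟨((x : R) : K) / y, hxyT⟩}) (f' : T)
    (hcrit : ∀ P : Ideal T, P ∈ derivCriticalPrimes T f' ↔
      (P.IsPrime ∧ P.height = 1 ∧ Subring.inclusion hRT x ∈ P)) :
    ∀ P : Ideal T, P ∈ derivCriticalPrimes T f' ↔
      (P = Ideal.span {Subring.inclusion hRT y} ∨ P = Ideal.span {(⟨((x : R) : K) / y, hxyT⟩ : T)}) := by
  have hx : Subring.inclusion hRT x = Subring.inclusion hRT y * ⟨((x : R) : K) / y, hxyT⟩ :=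
    inclusion_snd_eq_mul_div hy0 hRT hxyT
  exact mem_derivCriticalPrimes_iff_of_rsop₂ hdimT hmT f' (fun P => by rw [hcrit P, hx])

/-- **Origin of the chart of `y`, crossing centre** (`E(f) = {xy = 0}` at `ξ`): with
`𝔪_T = (y, x/y)`, if the critical primes of `f′` are the height-one primes containing
`x·y = y²·(x/y)`, they are `(y)` and `(x/y)` (both non-units). [cite: Giraud1983, 1.3 and Lemme 2.3 (i)] -/
theorem derivCriticalPrimes_chart_origin_of_mem₂ [IsRegularLocalRing T] (hdimT : ringKrullDim T = 2)
    (hy0 : y ≠ 0) (hRT : R ≤ T) (hxyT : ((x : R) : K) / y ∈ T)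
    (hmT : maximalIdeal T = Ideal.span {Subring.inclusion hRT y, ⟨((x : R) : K) / y, hxyT⟩}) (f' : T)
    (hcrit : ∀ P : Ideal T, P ∈ derivCriticalPrimes T f' ↔
      (P.IsPrime ∧ P.height = 1 ∧ Subring.inclusion hRT x * Subring.inclusion hRT y ∈ P)) :
    ∀ P : Ideal T, P ∈ derivCriticalPrimes T f' ↔
      ((¬ IsUnit (Subring.inclusion hRT y) ∧ P = Ideal.span {Subring.inclusion hRT y}) ∨
        (¬ IsUnit (⟨((x : R) : K) / y, hxyT⟩ : T) ∧ P = Ideal.span {(⟨((x : R) : K) / y, hxyT⟩ : T)})) := by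
  have hx : Subring.inclusion hRT x = Subring.inclusion hRT y * ⟨((x : R) : K) / y, hxyT⟩ :=
    inclusion_snd_eq_mul_div hy0 hRT hxyT
  have hmT' : maximalIdeal T = Ideal.span {(⟨((x : R) : K) / y, hxyT⟩ : T), Subring.inclusion hRT y} := by
    rw [hmT, Set.pair_comm]
  have hyp : Prime (Subring.inclusion hRT y) := (prime_and_not_dvd_of_maximalIdeal_eq_span_pair hdimT hmT).1
  have hzp : Prime (⟨((x : R) : K) / y, hxyT⟩ : T) :=
    (prime_and_not_dvd_of_maximalIdeal_eq_span_pair hdimT hmT').1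
  intro P
  have key : Subring.inclusion hRT x * Subring.inclusion hRT y =
      Subring.inclusion hRT y ^ 2 * (⟨((x : R) : K) / y, hxyT⟩ : T) ^ 1 := by
    rw [hx]; ring
  exact mem_derivCriticalPrimes_iff_of_generator_pow_mul_pow f' (a := 2) (b := 1) (by norm_num) le_rfl
    hyp (Or.inl hzp) (fun P => by rw [hcrit P, key]) P

end Summit.ResolutionOfSingularities.ResolutionOfSingularities.Theorems.RadicialJung.CleanModels

end
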